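import Summits.Parity.BatemanHorn.Theorems.IsogenyRedeiPencilSelmerDictionaryBSideOddPlaces
import Summits.Parity.BatemanHorn.Theorems.IsogenyRedeiPencilSelmerDictionaryBSideTwoAdic
import Summits.Parity.BatemanHorn.Theorems.IsogenyRedeiPencilSelmerDictionaryKernelCountAux

/-!
# Route IsogenyRedei: the `b`-side Selmer rank of the pencil IS `ω(t² + 1)` (item stmt-Parity-11620)

Negative evidence for the untyped support item `MomentsToParity` (stmt-Parity-11620) and, more
broadly, for the "moment engine" of route IsogenyRedei (SingleBlockMoments, stmt-Parity-11609;
WallLemma, stmt-Parity-11618).  The route posits that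
`s_φ(t) := twoIsogenySelmerRank (2t) (t² + 1)` — the `𝔽₂`-dimension of the descent on the divisors
of `b = t² + 1` for the pencil `E_t : y² = x³ + 2t·x² + (t² + 1)·x` — is "the corank of an
`𝔽₂`-matrix of Legendre symbols among the prime factors of `t² + 1`", fluctuating with a
Heath-Brown / Poonen–Rains-type law, so that the moments `Σ_{t ≤ x, t ≡ a (q)} 2^{k·s_φ(t)}` are
`c_k(q,a)·x + o(x)` — the HYPOTHESIS of `MomentsToParity`.

It is not so.  The crux line `toric-node-vacuity-cassels` of `PencilSelmerDictionary`
(stmt-Parity-11584) has landed the complete local analysis of this Selmer set: the odd places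
impose NO condition (`stub_bSideOddPlaces`: `a = 2t ≡ (1 + t)² (mod p)` at `p ∣ t² + 1`), the real
place excludes `d < 0` (`real_obstruction`, Glue file), and the place `2` is an explicit table
(`stub_bSideTwoAdic`).  This file draws the consequences for the RANK, sorry-free, no definitions:

* `pencilSelmer_subset_image`, `pencilSelmerRank_le` — for every `t`, the Selmer set consists of
  positive squarefree divisors of `t² + 1`, so `s_φ(t) ≤ ω(t² + 1)`;
* `pencilSelmer_eq_image`, `card_pencilSelmer_eq`, `pencilSelmerRank_eq_card_primeFactors` — for
  `t ≡ 1, 2 (mod 4)` (half of all `t`) the Selmer set is ALL positive squarefree divisors of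
  `t² + 1`: `#S = 2^{ω(t²+1)}` and `s_φ(t) = ω(t² + 1)` EXACTLY;
* `card_oddPrimeFactors_le_pencilSelmerRank_add_one` — for every `t ≥ 1`,
  `s_φ(t) ≥ ω_odd(t² + 1) − 1` (the divisors `≡ 1 (mod 8)` are always in);
* `neg_one_pow_pencilSelmerRank`, `two_pow_mul_pencilSelmerRank` — hence for `t ≡ 1, 2 (mod 4)`:
  `(−1)^{s_φ(t)} = (−1)^{ω(t²+1)}` (the "Selmer parity" is the `ω`-parity ON THE NOSE, by elementary
  descent — no root numbers, no Cassels) and `2^{k·s_φ(t)} = 2^{k·ω(t²+1)}`.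

Consequences (prose; the analytic lower bound is not formalised here).  (1) The `k`-th moment of
`2^{s_φ}` along `t ≡ 2 (mod 4)` is the `k`-th moment of `2^{ω(t²+1)}`, which is
`≍ x (log x)^{2^k − 1}` (already `k = 1` is a Hooley-type divisor sum of `n² + 1`, `≍ x log x`), and
along any progression it is `≥ 2^{−k} Σ 2^{k ω_odd(t²+1)}`: the hypothesis
"`= c_k(q,a)·x + o(x)`" of `MomentsToParity` is false for every `k ≥ 1`, so a literal typing of the
item would be VACUOUSLY true; and there is no fluctuating Rédei corank for a moment method to
average (the "Rédei matrix" of the route is `0 × 0`).  (2) "`Σ (−1)^{s_φ(t)} = o(x)`" is, on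
`t ≡ 1, 2 (mod 4)`, verbatim `Σ (−1)^{ω(t²+1)} = o(x)` — the crux QuadraticOmegaParity at
`f = X² + 1` itself, not a consequence of Selmer-group statistics.  Together with the model-level
parity-blindness (`Theorems/MomentsToParity/Negative/ModelParityBlind.lean`) this settles the item
as misstated/void.

References: J. H. Silverman, *The Arithmetic of Elliptic Curves*, 2nd ed. (2009), Prop. X.4.9
[cite: SilvermanAEC2009, Prop. X.4.9]; the landed sibling files
`IsogenyRedeiPencilSelmerDictionary{BSideOddPlaces, BSideTwoAdic, KernelCountAux}.lean`
(line `toric-node-vacuity-cassels`), whose theorems are used by name; the two short lemmas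
`real_obstruction`, `mod_four_of_dvd` of `IsogenyRedeiPencilSelmerDictionaryGlue.lean` are
re-proved here as private copies so that this file does not import the route's Theses file.
-/

namespace Summit.Parity.BatemanHorn.Theorems.MomentsToParity

open Finset
open Literature.NumberTheory.EllipticCurves
open Summit.Parity.BatemanHorn.Theorems.PencilSelmerDictionary

/-! ## Private copies of two lemmas of the Glue file (to keep the import cone Theses-free) -/

/-- The real place on the `b`-side: for `d < 0` (hence `d′ = (t²+1)/d < 0`) the form
`d u⁴ + 2t u²z² + d′ z⁴` is negative definite (`d · q = (d u² + t z²)² + z⁴`), so `w² = q` has no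
real point.  Private copy of `PencilSelmerDictionary.real_obstruction`. [folklore] -/
private theorem real_obstruction' (t : ℕ) {d : ℤ} (hd : d < 0) (hdvd : d ∣ (t : ℤ) ^ 2 + 1) :
    ¬ ((twoIsogenyQuartic (2 * (t : ℤ)) d (((t : ℤ) ^ 2 + 1) / d)).map
        (Int.castRingHom ℝ)).IsSoluble := by
  rintro ⟨u, z, w, h0, h⟩
  have hdd' : d * (((t : ℤ) ^ 2 + 1) / d) = (t : ℤ) ^ 2 + 1 := Int.mul_ediv_cancel' hdvd
  rw [eval_map_twoIsogenyQuartic] at h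
  simp only [eq_intCast] at h
  push_cast at h
  have hdd'R : (d : ℝ) * ((((t : ℤ) ^ 2 + 1) / d : ℤ) : ℝ) = (t : ℝ) ^ 2 + 1 := by
    exact_mod_cast hdd'
  have hdR : (d : ℝ) < 0 := by exact_mod_cast hd
  have key : (d : ℝ) * w ^ 2 = ((d : ℝ) * u ^ 2 + (t : ℝ) * z ^ 2) ^ 2 + z ^ 4 := by
    rw [h]
    linear_combination (z ^ 4) * hdd'R
  have hz : z = 0 := by
    by_contra hz
    have hz4 : 0 < z ^ 4 := Even.pow_pos ⟨2, rfl⟩ hz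
    nlinarith [sq_nonneg ((d : ℝ) * u ^ 2 + (t : ℝ) * z ^ 2), sq_nonneg w]
  subst hz
  have hu : u = 0 := by
    by_contra hu
    have hu4 : 0 < u ^ 4 := Even.pow_pos ⟨2, rfl⟩ hu
    have hd2 : 0 < (d : ℝ) * d := mul_pos_of_neg_of_neg hdR hdR
    nlinarith [mul_pos hd2 hu4, sq_nonneg w]
  subst hu
  rcases h0 with h0 | h0 <;> exact h0 rfl

/-- An odd prime factor of `t² + 1` is `≡ 1 (mod 4)` (`−1 ≡ t²` is a square mod `p`).  Private copy
of `PencilSelmerDictionary.mod_four_of_dvd`. [folklore] -/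
private theorem mod_four_of_dvd' (t : ℕ) {p : ℕ} (hp : p.Prime) (hp2 : p ≠ 2)
    (hdvd : p ∣ t ^ 2 + 1) : p % 4 = 1 := by
  haveI := Fact.mk hp
  have hsq : IsSquare (-1 : ZMod p) := by
    refine ⟨(t : ZMod p), ?_⟩
    have h0 : ((t ^ 2 + 1 : ℕ) : ZMod p) = 0 := (ZMod.natCast_eq_zero_iff _ _).mpr hdvd
    push_cast at h0
    linear_combination -h0
  have h4 := ZMod.exists_sq_eq_neg_one_iff.mp hsq
  rcases hp.eq_two_or_odd with h | h
  · exact absurd h hp2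
  · omega

/-! ## The Selmer set sits inside the positive squarefree divisors -/

/-- Members of the `b`-side Selmer set of the pencil are positive (the real place: for `d < 0` the
form `d u⁴ + 2t u²z² + d′ z⁴` is negative definite, `real_obstruction'`). [folklore] -/
theorem pos_of_mem_pencilSelmer (t : ℕ) {d : ℤ}
    (hd : d ∈ twoIsogenySelmerGroup (2 * (t : ℤ)) ((t : ℤ) ^ 2 + 1)) : 0 < d := by
  have hbne : (t : ℤ) ^ 2 + 1 ≠ 0 := by positivity
  obtain ⟨hsq, hdvd, hR, -⟩ := (mem_twoIsogenySelmerGroup_iff hbne).mp hd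
  rcases lt_or_gt_of_ne hsq.ne_zero with hneg | hpos
  · exact absurd hR (real_obstruction' t hneg hdvd)
  · exact hpos

/-- **Every `t`: `S(t) ⊆ {∏ Q : Q ⊆ primeFactors (t² + 1)}`** — each member is a positive squarefree
divisor of `t² + 1`, i.e. the product of a set of prime factors of `t² + 1`. [folklore] -/
theorem pencilSelmer_subset_image (t : ℕ) :
    twoIsogenySelmerGroup (2 * (t : ℤ)) ((t : ℤ) ^ 2 + 1) ⊆
      (t ^ 2 + 1).primeFactors.powerset.image (fun Q => ((∏ p ∈ Q, p : ℕ) : ℤ)) := by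
  intro d hd
  have hpos := pos_of_mem_pencilSelmer t hd
  have hsq := squarefree_of_mem_twoIsogenySelmerGroup hd
  have hdvd := dvd_of_mem_twoIsogenySelmerGroup hd
  obtain ⟨n, rfl⟩ : ∃ n : ℕ, d = n := ⟨d.toNat, (Int.toNat_of_nonneg hpos.le).symm⟩
  have hn_sq : Squarefree n := Int.squarefree_natCast.mp hsq
  have hn_dvd : n ∣ t ^ 2 + 1 := by exact_mod_cast hdvd
  have hn0 : t ^ 2 + 1 ≠ 0 := Nat.succ_ne_zero _
  have hmem : n ∈ (t ^ 2 + 1).divisors.filter Squarefree :=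
    Finset.mem_filter.mpr ⟨Nat.mem_divisors.mpr ⟨hn_dvd, hn0⟩, hn_sq⟩
  rw [squarefreeDivisors_eq_image hn0] at hmem
  obtain ⟨Q, hQ, hQn⟩ := Finset.mem_image.mp hmem
  exact Finset.mem_image.mpr ⟨Q, hQ, congrArg (fun m : ℕ => (m : ℤ)) hQn⟩

/-- The products of distinct sets of prime factors are distinct integers: the image has
`2^{ω(t² + 1)}` elements. [folklore] -/
theorem card_image_prod_primeFactors (t : ℕ) :
    ((t ^ 2 + 1).primeFactors.powerset.image (fun Q => ((∏ p ∈ Q, p : ℕ) : ℤ))).card =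
      2 ^ (t ^ 2 + 1).primeFactors.card := by
  rw [Finset.card_image_of_injOn, Finset.card_powerset]
  intro Q₁ h₁ Q₂ h₂ h
  exact prod_injOn_powerset_primeFactors (t ^ 2 + 1) h₁ h₂ (Nat.cast_injective h)

/-- **`#S(t) ≤ 2^{ω(t² + 1)}`** for every `t`. [folklore] -/
theorem card_pencilSelmer_le (t : ℕ) :
    (twoIsogenySelmerGroup (2 * (t : ℤ)) ((t : ℤ) ^ 2 + 1)).card ≤
      2 ^ (t ^ 2 + 1).primeFactors.card := by
  rw [← card_image_prod_primeFactors t]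
  exact Finset.card_le_card (pencilSelmer_subset_image t)

/-- **`s_φ(t) ≤ ω(t² + 1)`** for every `t` (sharpening the tree's `≤ ω + 1`: the negative classes are
never in the Selmer set). [folklore] -/
theorem pencilSelmerRank_le (t : ℕ) :
    twoIsogenySelmerRank (2 * (t : ℤ)) ((t : ℤ) ^ 2 + 1) ≤ (t ^ 2 + 1).primeFactors.card := by
  have h := Nat.log_mono_right (b := 2) (card_pencilSelmer_le t)
  rw [Nat.log_pow Nat.one_lt_two] at h
  exact h

/-! ## Residues modulo `8` of the odd squarefree divisors of `t² + 1` -/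

/-- An odd squarefree divisor of `t² + 1` is `≡ 1` or `≡ 5 (mod 8)`: it is the product of its prime
factors, each `≡ 1 (mod 4)` (`mod_four_of_dvd'`, `prod_mod_eight_eq`). [folklore] -/
theorem mod_eight_of_squarefree_dvd (t : ℕ) {m : ℕ} (hm : Squarefree m) (h2 : ¬ 2 ∣ m)
    (hdvd : m ∣ t ^ 2 + 1) : m % 8 = 1 ∨ m % 8 = 5 := by
  have hprod : ∏ p ∈ m.primeFactors, p = m := Nat.prod_primeFactors_of_squarefree hm
  have h8 : ∀ p ∈ m.primeFactors, p % 8 = 1 ∨ p % 8 = 5 := by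
    intro p hp
    have hpp : p.Prime := Nat.prime_of_mem_primeFactors hp
    have hpm : p ∣ m := Nat.dvd_of_mem_primeFactors hp
    have hp2 : p ≠ 2 := fun h => h2 (h ▸ hpm)
    have h4 := mod_four_of_dvd' t hpp hp2 (hpm.trans hdvd)
    omega
  have key := prod_mod_eight_eq m.primeFactors h8
  rw [hprod] at key
  split_ifs at key
  · exact Or.inl key
  · exact Or.inr key

/-- `t² + 1` is odd when `t` is even. [folklore] -/
theorem not_two_dvd_sq_add_one {t : ℕ} (ht : 2 ∣ t) : ¬ 2 ∣ t ^ 2 + 1 := by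
  obtain ⟨c, rfl⟩ := ht
  rintro ⟨k, hk⟩
  have : (2 * c) ^ 2 + 1 = 2 * (2 * c ^ 2) + 1 := by ring
  omega

/-! ## `t ≡ 1, 2 (mod 4)`: every positive squarefree divisor is a Selmer class -/

/-- **Membership.** For `t ≡ 1` or `2 (mod 4)`, EVERY positive squarefree `d ∣ t² + 1` lies in the
`b`-side Selmer set of `E_t`: odd places are vacuous (`stub_bSideOddPlaces`), and the `2`-adic table
(`stub_bSideTwoAdic`) is passed because an odd squarefree divisor is `≡ 1, 5 (mod 8)` (for even `d`,
which forces `t` odd, `d/2` is such a divisor). [folklore] -/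
theorem mem_pencilSelmer_of_mod_four (t : ℕ) (ht : t % 4 = 1 ∨ t % 4 = 2) {d : ℤ} (hd0 : 0 < d)
    (hsq : Squarefree d) (hdvd : d ∣ (t : ℤ) ^ 2 + 1) :
    d ∈ twoIsogenySelmerGroup (2 * (t : ℤ)) ((t : ℤ) ^ 2 + 1) := by
  have ht1 : 1 ≤ t := by omega
  have hbne : (t : ℤ) ^ 2 + 1 ≠ 0 := by positivity
  rw [mem_twoIsogenySelmerGroup_iff_of_pos hbne hd0]
  refine ⟨hsq, hdvd, fun p hp => ?_⟩
  by_cases hp2 : p = 2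
  · subst hp2
    refine (stub_bSideTwoAdic t ht1 d hd0 hsq hdvd).mpr ?_
    obtain ⟨n, rfl⟩ : ∃ n : ℕ, d = n := ⟨d.toNat, (Int.toNat_of_nonneg hd0.le).symm⟩
    have hn_sq : Squarefree n := Int.squarefree_natCast.mp hsq
    have hn_dvd : n ∣ t ^ 2 + 1 := by exact_mod_cast hdvd
    by_cases h2n : 2 ∣ n
    · -- `d` even: then `t² + 1` is even, so `t` is odd, i.e. `t ≡ 1 (mod 4)`
      have ht4 : t % 4 = 1 := by
        rcases ht with h | h
        · exact h
        · exact absurd (h2n.trans hn_dvd) (not_two_dvd_sq_add_one ⟨t / 2, by omega⟩)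
      obtain ⟨m, hm⟩ := h2n
      have h4n : ¬ 4 ∣ n := by
        rintro ⟨k, hk⟩
        have h22 : 2 * 2 ∣ n := ⟨k, by omega⟩
        have := Nat.isUnit_iff.mp (hn_sq 2 h22)
        omega
      have h2m : ¬ 2 ∣ m := by
        rintro ⟨k, hk⟩
        exact h4n ⟨k, by omega⟩
      have hm_sq : Squarefree m := hn_sq.squarefree_of_dvd ⟨2, by omega⟩
      have hm_dvd : m ∣ t ^ 2 + 1 := (Dvd.intro_left 2 hm.symm).trans hn_dvd
      have h8 := mod_eight_of_squarefree_dvd t hm_sq h2m hm_dvd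
      right
      refine ⟨by omega, ?_⟩
      rcases h8 with h1 | h5
      · exact Or.inl ⟨by omega, Or.inl ht4⟩
      · exact Or.inr ⟨by omega, Or.inl ht4⟩
    · -- `d` odd: `d ≡ 1, 5 (mod 8)`
      have h8 := mod_eight_of_squarefree_dvd t hn_sq h2n hn_dvd
      left
      refine ⟨by omega, ?_⟩
      rcases h8 with h1 | h5
      · exact Or.inl (by omega)
      · exact Or.inr ⟨by omega, ht⟩
  · exact stub_bSideOddPlaces t ht1 d hd0 hsq hdvd p hp2

/-- **The Selmer set for `t ≡ 1, 2 (mod 4)`** is exactly the set of products of sets of prime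
factors of `t² + 1` (all positive squarefree divisors). [folklore] -/
theorem pencilSelmer_eq_image (t : ℕ) (ht : t % 4 = 1 ∨ t % 4 = 2) :
    twoIsogenySelmerGroup (2 * (t : ℤ)) ((t : ℤ) ^ 2 + 1) =
      (t ^ 2 + 1).primeFactors.powerset.image (fun Q => ((∏ p ∈ Q, p : ℕ) : ℤ)) := by
  refine Finset.Subset.antisymm (pencilSelmer_subset_image t) ?_
  intro d hd
  obtain ⟨Q, hQ, rfl⟩ := Finset.mem_image.mp hd
  have hQ' : Q ⊆ (t ^ 2 + 1).primeFactors := Finset.mem_powerset.mp hQ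
  have hsqN : Squarefree (∏ p ∈ Q, p) := squarefree_prod_of_subset_primeFactors hQ'
  have hdvdN : (∏ p ∈ Q, p) ∣ t ^ 2 + 1 := prod_dvd_of_subset_primeFactors hQ'
  have h0 : 0 < ∏ p ∈ Q, p := Nat.pos_of_ne_zero hsqN.ne_zero
  refine mem_pencilSelmer_of_mod_four t ht ?_ (Int.squarefree_natCast.mpr hsqN) ?_
  · show (0 : ℤ) < ((∏ p ∈ Q, p : ℕ) : ℤ)
    exact_mod_cast h0
  · show ((∏ p ∈ Q, p : ℕ) : ℤ) ∣ (t : ℤ) ^ 2 + 1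
    exact_mod_cast hdvdN

/-- **`#S(t) = 2^{ω(t² + 1)}` for `t ≡ 1, 2 (mod 4)`.** [folklore] -/
theorem card_pencilSelmer_eq (t : ℕ) (ht : t % 4 = 1 ∨ t % 4 = 2) :
    (twoIsogenySelmerGroup (2 * (t : ℤ)) ((t : ℤ) ^ 2 + 1)).card =
      2 ^ (t ^ 2 + 1).primeFactors.card := by
  rw [pencilSelmer_eq_image t ht, card_image_prod_primeFactors]

/-- **`s_φ(t) = ω(t² + 1)` for `t ≡ 1, 2 (mod 4)`**: on half of all `t` the `b`-side isogeny
Selmer rank of the pencil is the number of prime factors of `t² + 1` — not a fluctuating corank.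
[folklore] -/
theorem pencilSelmerRank_eq_card_primeFactors (t : ℕ) (ht : t % 4 = 1 ∨ t % 4 = 2) :
    twoIsogenySelmerRank (2 * (t : ℤ)) ((t : ℤ) ^ 2 + 1) = (t ^ 2 + 1).primeFactors.card := by
  rw [twoIsogenySelmerRank, card_pencilSelmer_eq t ht, Nat.log_pow Nat.one_lt_two]

/-- **Selmer parity = `ω`-parity on the nose** (`t ≡ 1, 2 (mod 4)`): `(−1)^{s_φ(t)} = (−1)^{ω(t²+1)}`,
by elementary descent alone. [folklore] -/
theorem neg_one_pow_pencilSelmerRank (t : ℕ) (ht : t % 4 = 1 ∨ t % 4 = 2) :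
    (-1 : ℤ) ^ twoIsogenySelmerRank (2 * (t : ℤ)) ((t : ℤ) ^ 2 + 1) =
      (-1 : ℤ) ^ (t ^ 2 + 1).primeFactors.card := by
  rw [pencilSelmerRank_eq_card_primeFactors t ht]

/-- **The moment weight is a divisor function** (`t ≡ 1, 2 (mod 4)`): `2^{k·s_φ(t)} = 2^{k·ω(t²+1)}`
for every `k` — the summand of the `k`-th moment in the hypothesis of `MomentsToParity`. [folklore] -/
theorem two_pow_mul_pencilSelmerRank (t : ℕ) (ht : t % 4 = 1 ∨ t % 4 = 2) (k : ℕ) :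
    (2 : ℝ) ^ (k * twoIsogenySelmerRank (2 * (t : ℤ)) ((t : ℤ) ^ 2 + 1)) =
      (2 : ℝ) ^ (k * (t ^ 2 + 1).primeFactors.card) := by
  rw [pencilSelmerRank_eq_card_primeFactors t ht]

/-! ## Every `t ≥ 1`: `s_φ(t) ≥ ω_odd(t² + 1) − 1` -/

/-- A positive squarefree divisor `d ≡ 1 (mod 8)` of `t² + 1` is a Selmer class for every `t ≥ 1`
(first line of the `2`-adic table). [folklore] -/
theorem mem_pencilSelmer_of_mod_eight (t : ℕ) (ht : 1 ≤ t) {d : ℤ} (hd0 : 0 < d)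
    (hsq : Squarefree d) (hdvd : d ∣ (t : ℤ) ^ 2 + 1) (h8 : d % 8 = 1) :
    d ∈ twoIsogenySelmerGroup (2 * (t : ℤ)) ((t : ℤ) ^ 2 + 1) := by
  have hbne : (t : ℤ) ^ 2 + 1 ≠ 0 := by positivity
  rw [mem_twoIsogenySelmerGroup_iff_of_pos hbne hd0]
  refine ⟨hsq, hdvd, fun p hp => ?_⟩
  by_cases hp2 : p = 2
  · subst hp2
    exact (stub_bSideTwoAdic t ht d hd0 hsq hdvd).mpr (Or.inl ⟨by omega, Or.inl h8⟩)
  · exact stub_bSideOddPlaces t ht d hd0 hsq hdvd p hp2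

/-- **`2^{ω_odd(t²+1) − 1} ≤ #S(t)`** for every `t ≥ 1`: the products of the sets of odd prime
factors containing an even number of primes `≡ 5 (mod 8)` are `≡ 1 (mod 8)`, hence Selmer classes,
and there are at least `2^{ω_odd − 1}` of them (`card_powerset_filter_even_eq`). [folklore] -/
theorem two_pow_card_oddPrimeFactors_sub_one_le (t : ℕ) (ht : 1 ≤ t) :
    2 ^ (((t ^ 2 + 1).primeFactors.filter (fun p : ℕ => p ≠ 2)).card - 1) ≤
      (twoIsogenySelmerGroup (2 * (t : ℤ)) ((t : ℤ) ^ 2 + 1)).card := by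
  set Q := (t ^ 2 + 1).primeFactors.filter (fun p : ℕ => p ≠ 2) with hQ
  set F := Q.powerset.filter (fun S => Even (S.filter (fun p => p % 8 = 5)).card) with hF
  have hQP : Q ⊆ (t ^ 2 + 1).primeFactors := Finset.filter_subset _ _
  -- each product over `S ∈ F` is a Selmer class
  have hmap : ∀ S ∈ F, ((∏ p ∈ S, p : ℕ) : ℤ) ∈
      twoIsogenySelmerGroup (2 * (t : ℤ)) ((t : ℤ) ^ 2 + 1) := by
    intro S hS
    obtain ⟨hSQ, hE⟩ := Finset.mem_filter.mp hS
    have hSQ' : S ⊆ Q := Finset.mem_powerset.mp hSQ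
    have hSP : S ⊆ (t ^ 2 + 1).primeFactors := hSQ'.trans hQP
    have hsqN := squarefree_prod_of_subset_primeFactors hSP
    have hdvdN := prod_dvd_of_subset_primeFactors hSP
    have h8S : ∀ p ∈ S, p % 8 = 1 ∨ p % 8 = 5 := by
      intro p hp
      obtain ⟨hpP, hp2⟩ := Finset.mem_filter.mp (hSQ' hp)
      have hpp := Nat.prime_of_mem_primeFactors hpP
      have h4 := mod_four_of_dvd' t hpp hp2 (Nat.dvd_of_mem_primeFactors hpP)
      omega
    have hprod := prod_mod_eight_eq S h8S
    rw [if_pos hE] at hprod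
    have h0 : 0 < ∏ p ∈ S, p := Nat.pos_of_ne_zero hsqN.ne_zero
    refine mem_pencilSelmer_of_mod_eight t ht ?_ (Int.squarefree_natCast.mpr hsqN) ?_ ?_
    · exact_mod_cast h0
    · exact_mod_cast hdvdN
    · exact_mod_cast hprod
  -- and distinct sets give distinct products
  have hinj : Set.InjOn (fun S : Finset ℕ => ((∏ p ∈ S, p : ℕ) : ℤ)) (F : Set (Finset ℕ)) := by
    have aux : ∀ S ∈ (F : Set (Finset ℕ)),
        S ∈ ((t ^ 2 + 1).primeFactors.powerset : Set (Finset ℕ)) := by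
      intro S hS
      obtain ⟨hSQ, -⟩ := Finset.mem_filter.mp (Finset.mem_coe.mp hS)
      exact Finset.mem_coe.mpr (Finset.mem_powerset.mpr ((Finset.mem_powerset.mp hSQ).trans hQP))
    intro S₁ h₁ S₂ h₂ h
    exact prod_injOn_powerset_primeFactors (t ^ 2 + 1) (aux S₁ h₁) (aux S₂ h₂)
      (Nat.cast_injective h)
  have hFcard : 2 ^ (Q.card - 1) ≤ F.card := by
    by_cases h5 : ∃ a ∈ Q, a % 8 = 5
    · rw [hF, card_powerset_filter_even_eq (fun p => p % 8 = 5) Q h5]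
    · push Not at h5
      rw [hF, powerset_filter_even_eq_of_forall_not (fun p => p % 8 = 5) Q h5, Finset.card_powerset]
      exact Nat.pow_le_pow_right (by norm_num) (Nat.sub_le _ _)
  calc 2 ^ (Q.card - 1) ≤ F.card := hFcard
    _ = (F.image fun S => ((∏ p ∈ S, p : ℕ) : ℤ)).card := (Finset.card_image_of_injOn hinj).symm
    _ ≤ (twoIsogenySelmerGroup (2 * (t : ℤ)) ((t : ℤ) ^ 2 + 1)).card := by
        refine Finset.card_le_card fun d hd => ?_
        obtain ⟨S, hS, rfl⟩ := Finset.mem_image.mp hd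
        exact hmap S hS

/-- **`ω_odd(t² + 1) ≤ s_φ(t) + 1` for every `t ≥ 1`** (with `pencilSelmerRank_le`:
`ω_odd − 1 ≤ s_φ(t) ≤ ω`; the exact value `ω − r(t)`, `r(t) ∈ {0, 1}`, is the crux line's count).
So `2^{k·s_φ(t)} ≥ 2^{−k}·2^{k·ω_odd(t²+1)}` termwise in every moment. [folklore] -/
theorem card_oddPrimeFactors_le_pencilSelmerRank_add_one (t : ℕ) (ht : 1 ≤ t) :
    ((t ^ 2 + 1).primeFactors.filter (fun p : ℕ => p ≠ 2)).card ≤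
      twoIsogenySelmerRank (2 * (t : ℤ)) ((t : ℤ) ^ 2 + 1) + 1 := by
  have h1 := two_pow_card_oddPrimeFactors_sub_one_le t ht
  have h2 := card_lt_two_pow_twoIsogenySelmerRank_succ (2 * (t : ℤ)) ((t : ℤ) ^ 2 + 1)
  have h3 := (Nat.pow_lt_pow_iff_right (by norm_num : 1 < 2)).mp (lt_of_le_of_lt h1 h2)
  omega

/-- The same bound as an inequality of moment weights: `2^{ω_odd(t²+1) − 1} ≤ 2^{s_φ(t)}` (`t ≥ 1`).
[folklore] -/
theorem two_pow_card_oddPrimeFactors_sub_one_le_two_pow_rank (t : ℕ) (ht : 1 ≤ t) :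
    (2 : ℝ) ^ (((t ^ 2 + 1).primeFactors.filter (fun p : ℕ => p ≠ 2)).card - 1) ≤
      (2 : ℝ) ^ twoIsogenySelmerRank (2 * (t : ℤ)) ((t : ℤ) ^ 2 + 1) := by
  have h := card_oddPrimeFactors_le_pencilSelmerRank_add_one t ht
  exact pow_le_pow_right₀ (by norm_num) (by omega)

end Summit.Parity.BatemanHorn.Theorems.MomentsToParity
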